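import Mathlib
import Summits.AtomisticToContinuum.Crystallization.Theorems.SquareWellLayerCakeStackingFaultSparsityExactLatticeLedgerReindex
import Summits.AtomisticToContinuum.Crystallization.Theorems.PricedLinkCensusStackingHingeFarTail
import Literature.MathematicalPhysics.StatisticalMechanics.MatchedWindowTransfer

/-!
# Exact-lattice ledger, III: FAR pairs and the window (helper file)

Crux `StackingFaultSparsity` (item stmt-AtomisticToContinuum-14296, routes `SquareWellLayerCake` /
`LaminarSixThreeThree`), line `Sketch`, stub `stub_exactLatticeLedger` (survey obligation M3c+e, the
exact-lattice ledger of the cylinder block flip; landing file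
`SquareWellLayerCakeStackingFaultSparsityExactLatticeLedger.lean`, whose module docstring has the
overall map).

`ledger_far_site` (far partners of one site, `≤ C K⁻³`, proof contributed by the line lead via
`PricedHcpWindowsFarTail.stub_farTail`), `card_cyl_le` (the cylinder holds `≤ 91 ρ² (q₂ - q₁)`
points), `ledger_far` (carrier; FAR pairs `≤ C_F ρ² (q₂ - q₁) K⁻³`), `mem_window_of_disc` (all disc
indices of the layers `[q₁ - K, q₂]` are in the window).
-/

noncomputable section
namespace Summit.AtomisticToContinuum.Crystallization.Theorems.SquareWellLayerCake.StackingFaultSparsity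
open Literature.MathematicalPhysics.StatisticalMechanics

/-! ## 3. FAR pairs: layer gap `> K` (L5, tails) -/

/-- **Far partners of one site (L5; proof contributed by the line lead).** There is `C ≥ 0` such that for every index `q` of the
window the partners `q'` at layer gap `> K` contribute `∑ |Δ q q'| ≤ C K⁻³`: `Δ q q' = 0` unless
`q` or `q'` is a cylinder point, and in any case `|Δ| ≤ |V(new)| + |V(old)| ≤ 6 d_new⁻⁶ + 6 d_old⁻⁶`
(`abs_lennardJones_le_six`); the old partners `barlowPos q'` and the new ones `barlowPos q' + D q'`
form `1/2`-separated sets (`half_le_dist_old`, `half_le_dist_disp`) all at distance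
`≥ (K + 1) h ≥ 7K/10` from the (old resp. new) position of `q` (`vertical_le_dist_old/disp`), so
the far-shell tail `PricedHcpWindowsFarTail.stub_farTail` (`δ₀ = 1/2`, range `7K/10`) gives
`≤ 12 · C_farTail(1/2) · (10/7)³ K⁻³`. [folklore] -/
theorem ledger_far_site : ∃ C : ℝ, 0 ≤ C ∧ ∀ K : ℕ, 2 ≤ K →
    ∀ (a h : ℝ) (s : ℤ → ℤ) (q₁ q₂ i₀ j₀ : ℤ) (ρ R : ℝ) (I : Finset (ℤ × ℤ × ℤ))
      (D : ℤ × ℤ × ℤ → (EuclideanSpace ℝ (Fin 3))) (Δ : ℤ × ℤ × ℤ → ℤ × ℤ × ℤ → ℝ),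
      InBox a h → IsHaggSeq s → q₁ < q₂ → (3 : ℤ) ∣ haggLabel s q₂ - haggLabel s q₁ → 1 ≤ ρ →
      ρ + ((q₂ : ℝ) - q₁) * h + K * h + 1 ≤ R →
      (∀ q, InCyl a h s q₁ q₂ i₀ j₀ ρ q.1 q.2.1 q.2.2 →
        D q = ((shiftSign s q₁ q.1 : ℤ) : ℝ) • barlowOffset a) →
      (∀ q, ¬ InCyl a h s q₁ q₂ i₀ j₀ ρ q.1 q.2.1 q.2.2 → D q = 0) →
      (∀ q q', Δ q q' =
        lennardJones (dist (barlowPos a h s q.1 q.2.1 q.2.2 + D q)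
            (barlowPos a h s q'.1 q'.2.1 q'.2.2 + D q')) -
          lennardJones (dist (barlowPos a h s q.1 q.2.1 q.2.2)
            (barlowPos a h s q'.1 q'.2.1 q'.2.2))) →
      (∀ q, q ∈ I ↔ dist (barlowPos a h s q.1 q.2.1 q.2.2) (barlowPos a h s q₁ i₀ j₀) ≤ R) →
      ∀ q ∈ I, ∑ q' ∈ I.filter (fun q' => ((K : ℤ) < q'.1 - q.1 ∨ q'.1 - q.1 < -(K : ℤ))), |Δ q q'| ≤
        C * (K : ℝ)⁻¹ ^ 3 := by
  classical
  obtain ⟨CF, hCF0, hCF⟩ := PricedHcpWindowsFarTail.stub_farTail (1 / 2) (by norm_num)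
  refine ⟨12 * CF * (10 / 7) ^ 3, by positivity, ?_⟩
  intro K hK a h s q₁ q₂ i₀ j₀ ρ R I D Δ hbox _hs _hq _h3 _hρ _hR hD₁ hD₀ hΔ _hI q _hqI
  obtain ⟨_, _, hh7, _⟩ := InBox.bounds hbox
  set F : Finset (ℤ × ℤ × ℤ) :=
    I.filter (fun q' => ((K : ℤ) < q'.1 - q.1 ∨ q'.1 - q.1 < -(K : ℤ))) with hF
  set ℓ : ℝ := ((K : ℝ) + 1) * h with hℓ
  have hK2 : (2 : ℝ) ≤ K := by exact_mod_cast hK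
  have hKpos : (0 : ℝ) < K := by linarith
  have hℓK : 7 / 10 * K ≤ ℓ := by rw [hℓ]; nlinarith
  have hℓhalf : 1 / 2 ≤ ℓ := by linarith
  have hℓpos : 0 < ℓ := by linarith
  -- far partners have layer gap `≥ K + 1`
  have hgap : ∀ q' ∈ F, ℓ ≤ |((q.1 : ℝ) - q'.1) * h| := by
    intro q' hq'
    have hfar := (Finset.mem_filter.1 hq').2
    have hz : (K : ℤ) + 1 ≤ |q.1 - q'.1| := by
      rcases hfar with hfar | hfar
      · rw [abs_sub_comm]; exact le_trans (by omega) (le_abs_self _)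
      · exact le_trans (by omega) (le_abs_self _)
    have hr : (K : ℝ) + 1 ≤ |(q.1 : ℝ) - q'.1| := by
      have : (((K : ℤ) + 1 : ℤ) : ℝ) ≤ ((|q.1 - q'.1| : ℤ) : ℝ) := by exact_mod_cast hz
      push_cast at this
      exact this
    rw [abs_mul, abs_of_pos (by linarith : (0 : ℝ) < h), hℓ]
    exact mul_le_mul_of_nonneg_right hr (by linarith)
  have hqF : q ∉ F := by
    intro hqF'
    have := (Finset.mem_filter.1 hqF').2
    omega
  -- generic site bound through `stub_farTail`
  have site : ∀ pos : ℤ × ℤ × ℤ → (EuclideanSpace ℝ (Fin 3)),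
      (∀ x ∈ insert q F, ∀ x' ∈ insert q F, x ≠ x' → 1 / 2 ≤ dist (pos x) (pos x')) →
      (∀ q' ∈ F, ℓ ≤ dist (pos q) (pos q')) →
      ∑ q' ∈ F, (dist (pos q) (pos q'))⁻¹ ^ 6 ≤ CF * ℓ⁻¹ ^ 3 := by
    intro pos hsep hfar
    set G : Finset (ℤ × ℤ × ℤ) := insert q F with hG
    have hqG : q ∈ G := Finset.mem_insert_self _ _
    have hFG : F ⊆ G := Finset.subset_insert _ _
    set n : ℕ := G.card with hn
    set e := G.equivFin with he
    set y : Fin n → (EuclideanSpace ℝ (Fin 3)) := fun j => pos (e.symm j).1 with hy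
    have hysep : ∀ j j' : Fin n, j ≠ j' → 1 / 2 ≤ dist (y j) (y j') := by
      intro j j' hjj'
      refine hsep _ (e.symm j).2 _ (e.symm j').2 fun heq => hjj' ?_
      have : e.symm j = e.symm j' := Subtype.ext heq
      exact e.symm.injective this
    set i₁ : Fin n := e ⟨q, hqG⟩ with hi₁
    have key := hCF n y hysep i₁ ℓ hℓhalf
    have hyval : ∀ (x : ℤ × ℤ × ℤ) (hx : x ∈ G), y (e ⟨x, hx⟩) = pos x := by
      intro x hx; simp only [hy, Equiv.symm_apply_apply]
    have hy₁ : y i₁ = pos q := hyval q hqG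
    -- inject `F` into the far filter of `y`
    set φ : ℤ × ℤ × ℤ → Fin n := fun x => if hx : x ∈ G then e ⟨x, hx⟩ else i₁ with hφ
    have hφF : ∀ x (hx : x ∈ F), φ x = e ⟨x, hFG hx⟩ := fun x hx => by
      simp only [hφ, dif_pos (hFG hx)]
    have hinj : Set.InjOn φ F := by
      intro x hx x' hx' hxx'
      rw [hφF x hx, hφF x' hx'] at hxx'
      have := e.injective hxx'
      exact congrArg Subtype.val this
    have himg : F.image φ ⊆ (Finset.univ.erase i₁).filter (fun j => ℓ ≤ dist (y i₁) (y j)) := by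
      intro j hj
      obtain ⟨x, hx, rfl⟩ := Finset.mem_image.1 hj
      rw [hφF x hx]
      refine Finset.mem_filter.2 ⟨Finset.mem_erase.2 ⟨?_, Finset.mem_univ _⟩, ?_⟩
      · intro hxe
        have hxq : x = q := congrArg Subtype.val (e.injective hxe)
        exact hqF (hxq ▸ hx)
      · rw [hy₁, hyval x (hFG hx)]; exact hfar x hx
    calc ∑ q' ∈ F, (dist (pos q) (pos q'))⁻¹ ^ 6
        = ∑ j ∈ F.image φ, (dist (y i₁) (y j))⁻¹ ^ 6 := by
          rw [Finset.sum_image hinj]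
          refine Finset.sum_congr rfl fun x hx => ?_
          rw [hφF x hx, hy₁, hyval x (hFG hx)]
      _ ≤ ∑ j ∈ (Finset.univ.erase i₁).filter (fun j => ℓ ≤ dist (y i₁) (y j)),
            (dist (y i₁) (y j))⁻¹ ^ 6 :=
          Finset.sum_le_sum_of_subset_of_nonneg himg fun j _ _ => by positivity
      _ ≤ CF * ℓ⁻¹ ^ 3 := key
  -- new and old positions
  have hnew := site (fun x => barlowPos a h s x.1 x.2.1 x.2.2 + D x)
    (fun x _ x' _ hxx' => half_le_dist_disp hbox hD₁ hD₀ hxx')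
    (fun q' hq' => (hgap q' hq').trans (vertical_le_dist_disp hD₁ hD₀ q q'))
  have hold := site (fun x => barlowPos a h s x.1 x.2.1 x.2.2)
    (fun x _ x' _ hxx' => half_le_dist_old hbox s hxx')
    (fun q' hq' => (hgap q' hq').trans (vertical_le_dist_old a h s q q'))
  -- termwise bound
  have hterm : ∀ q' ∈ F, |Δ q q'| ≤
      6 * (dist (barlowPos a h s q.1 q.2.1 q.2.2 + D q) (barlowPos a h s q'.1 q'.2.1 q'.2.2 + D q'))⁻¹ ^ 6 +
      6 * (dist (barlowPos a h s q.1 q.2.1 q.2.2) (barlowPos a h s q'.1 q'.2.1 q'.2.2))⁻¹ ^ 6 := by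
    intro q' hq'
    rw [hΔ]
    refine (abs_sub _ _).trans (add_le_add ?_ ?_)
    · exact abs_lennardJones_le_six
        (hℓhalf.trans ((hgap q' hq').trans (vertical_le_dist_disp hD₁ hD₀ q q')))
    · exact abs_lennardJones_le_six
        (hℓhalf.trans ((hgap q' hq').trans (vertical_le_dist_old a h s q q')))
  have hℓ3 : ℓ⁻¹ ^ 3 ≤ (10 / 7) ^ 3 * (K : ℝ)⁻¹ ^ 3 := by
    rw [← mul_pow]
    refine pow_le_pow_left₀ (by positivity) ?_ 3
    rw [inv_le_iff_one_le_mul₀ hℓpos]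
    calc (1 : ℝ) = 10 / 7 * (K : ℝ)⁻¹ * (7 / 10 * K) := by field_simp
      _ ≤ 10 / 7 * (K : ℝ)⁻¹ * ℓ := by gcongr
  calc ∑ q' ∈ F, |Δ q q'|
      ≤ ∑ q' ∈ F, (6 * (dist (barlowPos a h s q.1 q.2.1 q.2.2 + D q)
            (barlowPos a h s q'.1 q'.2.1 q'.2.2 + D q'))⁻¹ ^ 6 +
          6 * (dist (barlowPos a h s q.1 q.2.1 q.2.2) (barlowPos a h s q'.1 q'.2.1 q'.2.2))⁻¹ ^ 6) :=
        Finset.sum_le_sum hterm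
    _ = 6 * ∑ q' ∈ F, (dist (barlowPos a h s q.1 q.2.1 q.2.2 + D q)
            (barlowPos a h s q'.1 q'.2.1 q'.2.2 + D q'))⁻¹ ^ 6 +
          6 * ∑ q' ∈ F, (dist (barlowPos a h s q.1 q.2.1 q.2.2)
            (barlowPos a h s q'.1 q'.2.1 q'.2.2))⁻¹ ^ 6 := by
        rw [Finset.sum_add_distrib, Finset.mul_sum, Finset.mul_sum]
    _ ≤ 6 * (CF * ℓ⁻¹ ^ 3) + 6 * (CF * ℓ⁻¹ ^ 3) := by gcongr
    _ = 12 * CF * ℓ⁻¹ ^ 3 := by ring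
    _ ≤ 12 * CF * ((10 / 7) ^ 3 * (K : ℝ)⁻¹ ^ 3) := by gcongr
    _ = 12 * CF * (10 / 7) ^ 3 * (K : ℝ)⁻¹ ^ 3 := by ring

/-- **The cylinder holds `≤ 91 ρ² (q₂ - q₁)` lattice points** (`MatchedWindowTransfer.card_le_of_lateral_sq_le`:
`≤ (q₂ - q₁)(8ρ/a + 1)²`, and `a ≥ 47/50`, `ρ ≥ 1`). [folklore] -/
theorem card_cyl_le : ∀ K : ℕ, 2 ≤ K →
    ∀ (a h : ℝ) (s : ℤ → ℤ) (q₁ q₂ i₀ j₀ : ℤ) (ρ R : ℝ) (I : Finset (ℤ × ℤ × ℤ))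
      (D : ℤ × ℤ × ℤ → (EuclideanSpace ℝ (Fin 3))) (Δ : ℤ × ℤ × ℤ → ℤ × ℤ × ℤ → ℝ),
      InBox a h → IsHaggSeq s → q₁ < q₂ → (3 : ℤ) ∣ haggLabel s q₂ - haggLabel s q₁ → 1 ≤ ρ →
      ρ + ((q₂ : ℝ) - q₁) * h + K * h + 1 ≤ R →
      (∀ q, InCyl a h s q₁ q₂ i₀ j₀ ρ q.1 q.2.1 q.2.2 →
        D q = ((shiftSign s q₁ q.1 : ℤ) : ℝ) • barlowOffset a) →
      (∀ q, ¬ InCyl a h s q₁ q₂ i₀ j₀ ρ q.1 q.2.1 q.2.2 → D q = 0) →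
      (∀ q q', Δ q q' =
        lennardJones (dist (barlowPos a h s q.1 q.2.1 q.2.2 + D q)
            (barlowPos a h s q'.1 q'.2.1 q'.2.2 + D q')) -
          lennardJones (dist (barlowPos a h s q.1 q.2.1 q.2.2)
            (barlowPos a h s q'.1 q'.2.1 q'.2.2))) →
      (∀ q, q ∈ I ↔ dist (barlowPos a h s q.1 q.2.1 q.2.2) (barlowPos a h s q₁ i₀ j₀) ≤ R) →
      (((I.filter (fun q => (q₁ < q.1 ∧ q.1 < q₂ ∧ latSq (barlowPos a h s q.1 q.2.1 q.2.2) (barlowPos a h s q₁ i₀ j₀) ≤ ρ ^ 2))).card : ℕ) : ℝ) ≤ 91 * ρ ^ 2 * ((q₂ : ℝ) - q₁) := by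
  intro K hK a h s q₁ q₂ i₀ j₀ ρ R I D Δ hbox hs hq hcharge hρ hR hD₁ hD₀ hΔ hI
  obtain ⟨ha, hh⟩ := InBox.pos hbox
  have hρ0 : 0 ≤ ρ := by linarith
  have h1 := card_le_of_lateral_sq_le ha hρ0 s hq.le i₀ j₀ (I.filter (fun q => (q₁ < q.1 ∧ q.1 < q₂ ∧ latSq (barlowPos a h s q.1 q.2.1 q.2.2) (barlowPos a h s q₁ i₀ j₀) ≤ ρ ^ 2)))
    (fun t ht => by
      rw [Finset.mem_filter] at ht
      exact ⟨ht.2.1, ht.2.2.1, ht.2.2.2⟩)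
  refine h1.trans ?_
  have hq0 : (0 : ℝ) ≤ (q₂ : ℝ) - q₁ := by
    have : (q₁ : ℝ) < q₂ := by exact_mod_cast hq
    linarith
  have hb : (8 * ρ / a + 1) ^ 2 ≤ 91 * ρ ^ 2 := by
    have ha1 : 47 / 50 ≤ a := hbox.1
    have h8 : 8 * ρ / a ≤ 8 * ρ / (47 / 50) :=
      div_le_div_of_nonneg_left (by positivity) (by norm_num) ha1
    have h9 : 8 * ρ / a + 1 ≤ (447 / 47) * ρ := by
      have : 8 * ρ / (47 / 50) = 400 / 47 * ρ := by ring
      nlinarith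
    calc (8 * ρ / a + 1) ^ 2 ≤ ((447 / 47) * ρ) ^ 2 := pow_le_pow_left₀ (by positivity) h9 2
      _ ≤ 91 * ρ ^ 2 := by nlinarith [sq_nonneg ρ]
  nlinarith [mul_le_mul_of_nonneg_left hb hq0]

/-- **FAR pairs** (assembly of `ledger_far_site` and `card_cyl_le`): the ordered pairs at layer gap
`> K` contribute `∑ |Δ| ≤ C_F ρ² (q₂ - q₁) K⁻³`, `C_F = 182 C`: a far pair with no cylinder endpoint
is unchanged, so the double sum is dominated by twice the sum over the pairs whose FIRST index is a
cylinder point. [folklore] -/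
theorem ledger_far : ∃ C_F : ℝ, 0 ≤ C_F ∧ ∀ K : ℕ, 2 ≤ K →
    ∀ (a h : ℝ) (s : ℤ → ℤ) (q₁ q₂ i₀ j₀ : ℤ) (ρ R : ℝ) (I : Finset (ℤ × ℤ × ℤ))
      (D : ℤ × ℤ × ℤ → (EuclideanSpace ℝ (Fin 3))) (Δ : ℤ × ℤ × ℤ → ℤ × ℤ × ℤ → ℝ),
      InBox a h → IsHaggSeq s → q₁ < q₂ → (3 : ℤ) ∣ haggLabel s q₂ - haggLabel s q₁ → 1 ≤ ρ →
      ρ + ((q₂ : ℝ) - q₁) * h + K * h + 1 ≤ R →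
      (∀ q, InCyl a h s q₁ q₂ i₀ j₀ ρ q.1 q.2.1 q.2.2 →
        D q = ((shiftSign s q₁ q.1 : ℤ) : ℝ) • barlowOffset a) →
      (∀ q, ¬ InCyl a h s q₁ q₂ i₀ j₀ ρ q.1 q.2.1 q.2.2 → D q = 0) →
      (∀ q q', Δ q q' =
        lennardJones (dist (barlowPos a h s q.1 q.2.1 q.2.2 + D q)
            (barlowPos a h s q'.1 q'.2.1 q'.2.2 + D q')) -
          lennardJones (dist (barlowPos a h s q.1 q.2.1 q.2.2)
            (barlowPos a h s q'.1 q'.2.1 q'.2.2))) →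
      (∀ q, q ∈ I ↔ dist (barlowPos a h s q.1 q.2.1 q.2.2) (barlowPos a h s q₁ i₀ j₀) ≤ R) →
      ∑ q ∈ I, ∑ q' ∈ I.filter (fun q' => ((K : ℤ) < q'.1 - q.1 ∨ q'.1 - q.1 < -(K : ℤ))),
          |Δ q q'| ≤ C_F * ρ ^ 2 * ((q₂ : ℝ) - q₁) * (K : ℝ)⁻¹ ^ 3 := by
  obtain ⟨C, hC0, hsite⟩ := ledger_far_site
  refine ⟨182 * C, by positivity, ?_⟩
  intro K hK a h s q₁ q₂ i₀ j₀ ρ R I D Δ hbox hs hq hcharge hρ hR hD₁ hD₀ hΔ hI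
  classical
  have hS := hsite K hK a h s q₁ q₂ i₀ j₀ ρ R I D Δ hbox hs hq hcharge hρ hR hD₁ hD₀ hΔ hI
  have hcard := card_cyl_le K hK a h s q₁ q₂ i₀ j₀ ρ R I D Δ hbox hs hq hcharge hρ hR hD₁ hD₀ hΔ hI
  have hsymm : ∀ q q', Δ q q' = Δ q' q := pairChange_symm hΔ
  have hK0 : (0 : ℝ) ≤ (K : ℝ)⁻¹ ^ 3 := by positivity
  -- pointwise domination of the far indicator by the two "cylinder-first" indicators
  have hpt : ∀ q q' : ℤ × ℤ × ℤ,
      (if ((K : ℤ) < q'.1 - q.1 ∨ q'.1 - q.1 < -(K : ℤ)) then |Δ q q'| else 0) ≤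
        (if (q₁ < q.1 ∧ q.1 < q₂ ∧ latSq (barlowPos a h s q.1 q.2.1 q.2.2) (barlowPos a h s q₁ i₀ j₀) ≤ ρ ^ 2) ∧ ((K : ℤ) < q'.1 - q.1 ∨ q'.1 - q.1 < -(K : ℤ)) then |Δ q q'| else 0) +
        (if (q₁ < q'.1 ∧ q'.1 < q₂ ∧ latSq (barlowPos a h s q'.1 q'.2.1 q'.2.2) (barlowPos a h s q₁ i₀ j₀) ≤ ρ ^ 2) ∧ ((K : ℤ) < q.1 - q'.1 ∨ q.1 - q'.1 < -(K : ℤ)) then |Δ q' q| else 0) := by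
    intro q q'
    by_cases hf : ((K : ℤ) < q'.1 - q.1 ∨ q'.1 - q.1 < -(K : ℤ))
    · have hf' : (K : ℤ) < q.1 - q'.1 ∨ q.1 - q'.1 < -(K : ℤ) := by omega
      rw [if_pos hf]
      by_cases hc : (q₁ < q.1 ∧ q.1 < q₂ ∧ latSq (barlowPos a h s q.1 q.2.1 q.2.2) (barlowPos a h s q₁ i₀ j₀) ≤ ρ ^ 2)
      · rw [if_pos ⟨hc, hf⟩]
        have : 0 ≤ (if (q₁ < q'.1 ∧ q'.1 < q₂ ∧ latSq (barlowPos a h s q'.1 q'.2.1 q'.2.2) (barlowPos a h s q₁ i₀ j₀) ≤ ρ ^ 2) ∧ ((K : ℤ) < q.1 - q'.1 ∨ q.1 - q'.1 < -(K : ℤ))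
            then |Δ q' q| else 0) := by split_ifs <;> simp
        linarith
      · rw [if_neg (fun h0 => hc h0.1), zero_add]
        by_cases hc' : (q₁ < q'.1 ∧ q'.1 < q₂ ∧ latSq (barlowPos a h s q'.1 q'.2.1 q'.2.2) (barlowPos a h s q₁ i₀ j₀) ≤ ρ ^ 2)
        · rw [if_pos ⟨hc', hf'⟩, hsymm q q']
        · rw [if_neg (fun h0 => hc' h0.1)]
          have h0 : Δ q q' = 0 := pairChange_eq_zero_of_disp_eq hΔ (by rw [hD₀ q hc, hD₀ q' hc'])
          simp [h0]
    · rw [if_neg hf]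
      apply add_nonneg <;> split_ifs <;> simp
  -- sum it
  have step1 : ∑ q ∈ I, ∑ q' ∈ I.filter (fun q' => ((K : ℤ) < q'.1 - q.1 ∨ q'.1 - q.1 < -(K : ℤ))), |Δ q q'| ≤
      2 * ∑ q ∈ I, ∑ q' ∈ I, (if (q₁ < q.1 ∧ q.1 < q₂ ∧ latSq (barlowPos a h s q.1 q.2.1 q.2.2) (barlowPos a h s q₁ i₀ j₀) ≤ ρ ^ 2) ∧ ((K : ℤ) < q'.1 - q.1 ∨ q'.1 - q.1 < -(K : ℤ)) then |Δ q q'| else 0) := by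
    calc ∑ q ∈ I, ∑ q' ∈ I.filter (fun q' => ((K : ℤ) < q'.1 - q.1 ∨ q'.1 - q.1 < -(K : ℤ))), |Δ q q'|
        = ∑ q ∈ I, ∑ q' ∈ I, (if ((K : ℤ) < q'.1 - q.1 ∨ q'.1 - q.1 < -(K : ℤ)) then |Δ q q'| else 0) := by
          simp only [Finset.sum_filter]
      _ ≤ ∑ q ∈ I, ∑ q' ∈ I,
          ((if (q₁ < q.1 ∧ q.1 < q₂ ∧ latSq (barlowPos a h s q.1 q.2.1 q.2.2) (barlowPos a h s q₁ i₀ j₀) ≤ ρ ^ 2) ∧ ((K : ℤ) < q'.1 - q.1 ∨ q'.1 - q.1 < -(K : ℤ)) then |Δ q q'| else 0) +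
           (if (q₁ < q'.1 ∧ q'.1 < q₂ ∧ latSq (barlowPos a h s q'.1 q'.2.1 q'.2.2) (barlowPos a h s q₁ i₀ j₀) ≤ ρ ^ 2) ∧ ((K : ℤ) < q.1 - q'.1 ∨ q.1 - q'.1 < -(K : ℤ))
              then |Δ q' q| else 0)) :=
          Finset.sum_le_sum fun q _ => Finset.sum_le_sum fun q' _ => hpt q q'
      _ = ∑ q ∈ I, ∑ q' ∈ I, (if (q₁ < q.1 ∧ q.1 < q₂ ∧ latSq (barlowPos a h s q.1 q.2.1 q.2.2) (barlowPos a h s q₁ i₀ j₀) ≤ ρ ^ 2) ∧ ((K : ℤ) < q'.1 - q.1 ∨ q'.1 - q.1 < -(K : ℤ)) then |Δ q q'| else 0) +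
          ∑ q ∈ I, ∑ q' ∈ I, (if (q₁ < q'.1 ∧ q'.1 < q₂ ∧ latSq (barlowPos a h s q'.1 q'.2.1 q'.2.2) (barlowPos a h s q₁ i₀ j₀) ≤ ρ ^ 2) ∧ ((K : ℤ) < q.1 - q'.1 ∨ q.1 - q'.1 < -(K : ℤ))
              then |Δ q' q| else 0) := by
          rw [← Finset.sum_add_distrib]
          exact Finset.sum_congr rfl fun q _ => Finset.sum_add_distrib
      _ = 2 * ∑ q ∈ I, ∑ q' ∈ I, (if (q₁ < q.1 ∧ q.1 < q₂ ∧ latSq (barlowPos a h s q.1 q.2.1 q.2.2) (barlowPos a h s q₁ i₀ j₀) ≤ ρ ^ 2) ∧ ((K : ℤ) < q'.1 - q.1 ∨ q'.1 - q.1 < -(K : ℤ)) then |Δ q q'| else 0) := by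
          rw [Finset.sum_comm (f := fun q q' =>
            (if (q₁ < q'.1 ∧ q'.1 < q₂ ∧ latSq (barlowPos a h s q'.1 q'.2.1 q'.2.2) (barlowPos a h s q₁ i₀ j₀) ≤ ρ ^ 2) ∧ ((K : ℤ) < q.1 - q'.1 ∨ q.1 - q'.1 < -(K : ℤ))
              then |Δ q' q| else 0))]
          ring
  have step2 : ∑ q ∈ I, ∑ q' ∈ I, (if (q₁ < q.1 ∧ q.1 < q₂ ∧ latSq (barlowPos a h s q.1 q.2.1 q.2.2) (barlowPos a h s q₁ i₀ j₀) ≤ ρ ^ 2) ∧ ((K : ℤ) < q'.1 - q.1 ∨ q'.1 - q.1 < -(K : ℤ)) then |Δ q q'| else 0) =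
      ∑ q ∈ I.filter (fun q => (q₁ < q.1 ∧ q.1 < q₂ ∧ latSq (barlowPos a h s q.1 q.2.1 q.2.2) (barlowPos a h s q₁ i₀ j₀) ≤ ρ ^ 2)),
        ∑ q' ∈ I.filter (fun q' => ((K : ℤ) < q'.1 - q.1 ∨ q'.1 - q.1 < -(K : ℤ))), |Δ q q'| := by
    rw [Finset.sum_filter]
    refine Finset.sum_congr rfl fun q _ => ?_
    rw [Finset.sum_filter]
    split_ifs with hc
    · exact Finset.sum_congr rfl fun q' _ => by simp only [hc, true_and]
    · exact Finset.sum_eq_zero fun q' _ => by simp only [hc, false_and, if_false]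
  have step3 : ∑ q ∈ I.filter (fun q => (q₁ < q.1 ∧ q.1 < q₂ ∧ latSq (barlowPos a h s q.1 q.2.1 q.2.2) (barlowPos a h s q₁ i₀ j₀) ≤ ρ ^ 2)),
        ∑ q' ∈ I.filter (fun q' => ((K : ℤ) < q'.1 - q.1 ∨ q'.1 - q.1 < -(K : ℤ))), |Δ q q'| ≤
      (((I.filter (fun q => (q₁ < q.1 ∧ q.1 < q₂ ∧ latSq (barlowPos a h s q.1 q.2.1 q.2.2) (barlowPos a h s q₁ i₀ j₀) ≤ ρ ^ 2))).card : ℕ) : ℝ) * (C * (K : ℝ)⁻¹ ^ 3) := by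
    rw [← nsmul_eq_mul, ← Finset.sum_const]
    exact Finset.sum_le_sum fun q hq' => hS q (Finset.mem_of_mem_filter q hq')
  have hρ2 : (0 : ℝ) ≤ ρ ^ 2 := sq_nonneg ρ
  have hq0 : (0 : ℝ) ≤ (q₂ : ℝ) - q₁ := by
    have : (q₁ : ℝ) < q₂ := by exact_mod_cast hq
    linarith
  calc ∑ q ∈ I, ∑ q' ∈ I.filter (fun q' => ((K : ℤ) < q'.1 - q.1 ∨ q'.1 - q.1 < -(K : ℤ))), |Δ q q'|
      ≤ 2 * ((((I.filter (fun q => (q₁ < q.1 ∧ q.1 < q₂ ∧ latSq (barlowPos a h s q.1 q.2.1 q.2.2) (barlowPos a h s q₁ i₀ j₀) ≤ ρ ^ 2))).card : ℕ) : ℝ) * (C * (K : ℝ)⁻¹ ^ 3)) := by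
        rw [step2] at step1; linarith [step3]
    _ ≤ 2 * ((91 * ρ ^ 2 * ((q₂ : ℝ) - q₁)) * (C * (K : ℝ)⁻¹ ^ 3)) := by
        gcongr
    _ = 182 * C * ρ ^ 2 * ((q₂ : ℝ) - q₁) * (K : ℝ)⁻¹ ^ 3 := by ring

/-- **All disc indices of the layers `[q₁ - K, q₂]` are in the window**: lateral distance `≤ ρ` and
vertical distance `≤ (q₂ - q₁ + K) h` give distance `≤ ρ + (q₂ - q₁) h + K h ≤ R - 1`. [folklore] -/
theorem mem_window_of_disc : ∀ K : ℕ, 2 ≤ K →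
    ∀ (a h : ℝ) (s : ℤ → ℤ) (q₁ q₂ i₀ j₀ : ℤ) (ρ R : ℝ) (I : Finset (ℤ × ℤ × ℤ))
      (D : ℤ × ℤ × ℤ → (EuclideanSpace ℝ (Fin 3))) (Δ : ℤ × ℤ × ℤ → ℤ × ℤ × ℤ → ℝ),
      InBox a h → IsHaggSeq s → q₁ < q₂ → (3 : ℤ) ∣ haggLabel s q₂ - haggLabel s q₁ → 1 ≤ ρ →
      ρ + ((q₂ : ℝ) - q₁) * h + K * h + 1 ≤ R →
      (∀ q, InCyl a h s q₁ q₂ i₀ j₀ ρ q.1 q.2.1 q.2.2 →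
        D q = ((shiftSign s q₁ q.1 : ℤ) : ℝ) • barlowOffset a) →
      (∀ q, ¬ InCyl a h s q₁ q₂ i₀ j₀ ρ q.1 q.2.1 q.2.2 → D q = 0) →
      (∀ q q', Δ q q' =
        lennardJones (dist (barlowPos a h s q.1 q.2.1 q.2.2 + D q)
            (barlowPos a h s q'.1 q'.2.1 q'.2.2 + D q')) -
          lennardJones (dist (barlowPos a h s q.1 q.2.1 q.2.2)
            (barlowPos a h s q'.1 q'.2.1 q'.2.2))) →
      (∀ q, q ∈ I ↔ dist (barlowPos a h s q.1 q.2.1 q.2.2) (barlowPos a h s q₁ i₀ j₀) ≤ R) →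
      ∀ m ∈ Finset.Icc (q₁ - K) q₂, ∀ i j : ℤ,
        latSq (barlowPos a h s m i j) (barlowPos a h s q₁ i₀ j₀) ≤ ρ ^ 2 → (m, i, j) ∈ I := by
  intro K hK a h s q₁ q₂ i₀ j₀ ρ R I D Δ hbox hs hq hcharge hρ hR hD₁ hD₀ hΔ hI m hm i j hlat
  obtain ⟨ha, hh⟩ := InBox.pos hbox
  rw [Finset.mem_Icc] at hm
  rw [hI]
  dsimp only
  have hρ0 : 0 ≤ ρ := by linarith
  set V : ℝ := ((q₂ : ℝ) - q₁ + K) * h with hV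
  have hV0 : 0 ≤ V := by
    have : (0 : ℝ) ≤ (q₂ : ℝ) - q₁ + K := by
      have h1 : (q₁ : ℝ) < q₂ := by exact_mod_cast hq
      have h2 : (0 : ℝ) ≤ K := Nat.cast_nonneg K
      linarith
    exact mul_nonneg this hh.le
  have hvert : (((m : ℝ) - q₁) * h) ^ 2 ≤ V ^ 2 := by
    have h1 : |(m : ℝ) - q₁| ≤ (q₂ : ℝ) - q₁ + K := by
      rw [abs_le]
      constructor
      · have : ((q₁ - K : ℤ) : ℝ) ≤ m := by exact_mod_cast hm.1
        push_cast at this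
        have h1 : (q₁ : ℝ) < q₂ := by exact_mod_cast hq
        linarith
      · have : (m : ℝ) ≤ q₂ := by exact_mod_cast hm.2
        have h2 : (0 : ℝ) ≤ K := Nat.cast_nonneg K
        linarith
    have h2 : |((m : ℝ) - q₁) * h| ≤ V := by
      rw [abs_mul, abs_of_pos hh, hV]
      exact mul_le_mul_of_nonneg_right h1 hh.le
    exact sq_le_sq' (by linarith [abs_le.1 h2 |>.1]) (abs_le.1 h2).2
  have hsq : dist (barlowPos a h s m i j) (barlowPos a h s q₁ i₀ j₀) ^ 2 =
      latSq (barlowPos a h s m i j) (barlowPos a h s q₁ i₀ j₀) + (((m : ℝ) - q₁) * h) ^ 2 := by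
    rw [EuclideanSpace.dist_sq_eq, Fin.sum_univ_three, Real.dist_eq, Real.dist_eq, Real.dist_eq,
      sq_abs, sq_abs, sq_abs, latSq, barlowPos_apply_two, barlowPos_apply_two]
    ring
  have hle : dist (barlowPos a h s m i j) (barlowPos a h s q₁ i₀ j₀) ^ 2 ≤ (ρ + V) ^ 2 := by
    rw [hsq]; nlinarith [mul_nonneg hρ0 hV0]
  have h1 : dist (barlowPos a h s m i j) (barlowPos a h s q₁ i₀ j₀) ≤ ρ + V :=
    (pow_le_pow_iff_left₀ dist_nonneg (by positivity) two_ne_zero).1 hle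
  have h2 : ρ + V ≤ R := by rw [hV]; nlinarith
  exact h1.trans h2

end Summit.AtomisticToContinuum.Crystallization.Theorems.SquareWellLayerCake.StackingFaultSparsity

end
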